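import Summits.MatrixMultiplication.MatrixMultiplication.Theorems.AbelianSTPPCensusFP4Defs

/-!
# Rule U11-F4 at `604 = 4·151`: kernel certificate, table `ℤ/2 × ℤ/2`, chunks 1–3 of 6

Cell mm-stpp (rung F-M1), theory lane (seat mm-stpp-theory, gen 17).  Part of the FP4 certificate (`FP4.check`, `AbelianSTPPCensusFP4Defs`) for
the list `(7,7,7)⁴ + (5,6,7)` at `604 = 4·151` (`p = 151`; totals `(P_AB, P_BC, P_CA) = (226, 238, 231)`, letter maxima
`(7,7,7)`, minima `(5,6,7)`, menu `[6,11]`, `2` propagation rounds) for the table `e = 0` (`ℤ/2 × ℤ/2`):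
the bisection tree of this table (3435 nodes; exact Python twin `calc/fp4lean_twin.py`, chunking `calc/twin_frontier.py`) is cut into
6 sub-boxes; this file certifies sub-boxes 1–3 of 6 (971, 395, 381 nodes) by `decide` with kernel reduction (4 chunk files in all;
`AbelianSTPPCensusFP4Wall604.lean` glues them with `FP4.certify_step`).
WHAT THIS IS NOT: no claim by itself (pieces of one certificate); no census number; no `ω` statement.
-/

set_option linter.dupNamespace false -- `MatrixMultiplication.MatrixMultiplication` (summit = problem, D-0017)
set_option autoImplicit false

namespace Summit.MatrixMultiplication.MatrixMultiplication.Theorems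

namespace FP4Wall604

/-- Certified sub-box `LLLLL` of the FP4 certificate at `M = 604`, table `e = 0` (971 nodes of the bisection; `decide` with kernel reduction). [bookkeeping] -/
theorem c0_LLLLL : FP4.certify 151 0 226 238 231 7 7 7 5 6 7 [6,11] 2 35
    ⟨⟨0, 0, 0, 0⟩, ⟨75, 75, 151, 151⟩, ⟨0, 0, 0, 0⟩, ⟨75, 75, 151, 151⟩, ⟨0, 0, 0, 0⟩, ⟨75, 151, 151, 151⟩⟩ = true := by
  decide +kernel

/-- Certified sub-box `LLLLR` of the FP4 certificate at `M = 604`, table `e = 0` (395 nodes of the bisection; `decide` with kernel reduction). [bookkeeping] -/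
theorem c0_LLLLR : FP4.certify 151 0 226 238 231 7 7 7 5 6 7 [6,11] 2 35
    ⟨⟨0, 0, 0, 0⟩, ⟨75, 75, 151, 151⟩, ⟨0, 76, 0, 0⟩, ⟨75, 151, 151, 151⟩, ⟨0, 0, 0, 0⟩, ⟨75, 151, 151, 151⟩⟩ = true := by
  decide +kernel

/-- Certified sub-box `LLLR` of the FP4 certificate at `M = 604`, table `e = 0` (381 nodes of the bisection; `decide` with kernel reduction). [bookkeeping] -/
theorem c0_LLLR : FP4.certify 151 0 226 238 231 7 7 7 5 6 7 [6,11] 2 36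
    ⟨⟨0, 76, 0, 0⟩, ⟨75, 151, 151, 151⟩, ⟨0, 0, 0, 0⟩, ⟨75, 151, 151, 151⟩, ⟨0, 0, 0, 0⟩, ⟨75, 151, 151, 151⟩⟩ = true := by
  decide +kernel

end FP4Wall604

end Summit.MatrixMultiplication.MatrixMultiplication.Theorems
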